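import Summits.Parity.GeneralizedHardyLittlewood.Theses.LeeYangFibres
import Literature.NumberTheory.Sieve.LinearEquationsInPrimesProofs
import Literature.NumberTheory.Sieve.LinearEquationsInPrimesSingularSeries
import Summits.Parity.GeneralizedHardyLittlewood.Theorems.LeeYangFibresAbsoluteUpgradeSlices
import Summits.Parity.GeneralizedHardyLittlewood.Theorems.LeeYangFibresCellParityLawSingularRatio
import HarnessLib

/-!
# `AbsoluteUpgrade` (stmt-Parity-14116): the parametric upgrade is false (negative lemmas)

Crux `LeeYangFibres.AbsoluteUpgrade := RelativeDimOne → DimOne` upgrades the RELATIVE accuracy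
`ε (β_∞ ∏_p β_p + N)` (Green–Tao Conj. 1.4 shape) of the `d = 1` Hardy–Littlewood statement to the
ABSOLUTE accuracy `ε N` of Conj. 1.2.  Landed from the cdisprove work file
`Cruxes/AbsoluteUpgrade/Disproof.lean` so that ideators / planners / provers can import it.

* `RelShape S`, `AbsShape S` — the two statements with `vonMangoldtSum` replaced by a black-box
  functional `S` of the admissible data (`relShape_vonMangoldt_iff`, `absShape_vonMangoldt_iff`:
  at `S = Λ` they ARE `RelativeDimOne`, `DimOne`, by `Iff.rfl`); `UpgradeSchema := ∀ S, RelShape S →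
  AbsShape S` is the natural strengthening "the upgrade is formal" (it instantiates to the crux).
* `HighMassInhabited` — the statement of the tree theorem `exists_highMass_pair`
  (`Theorems/LeeYangFibresAbsoluteUpgradeHighMass`: primorial shift pairs `(n, n + w#)`,
  `∏_p β_p ≥ ½ ∑_{p ≤ w} 1/p`, unbounded); carried here as a HYPOTHESIS so that this file does not
  depend on that module (the unconditional corollaries are one application away).
* `relShape_perturbedSum`, `not_absShape_perturbedSum`, **`not_upgradeSchema_of_highMass`** — the
  schema is FALSE: the functional `perturbedSum` (true main term `+ N` exactly on the pairs of
  singular mass `≥ G(N) N`, with a threshold `G → ∞` grown along the high-mass scales) has relative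
  accuracy `o(1)` uniformly but absolute error `N` at infinitely many scales, `(t, L) = (2, 3)`.
  Consequence: no proof of the crux can use `RelativeDimOne` as a black-box inequality; arithmetic
  of `Λ` on the high-singular-series systems is needed.
* `upgradeSchema_of_uniformMassBound`, **`not_uniformMassBound_of_highMass`**,
  `not_massBound_two_three_of_highMass` — the only formal bridge (ε-rescaling) needs a uniform
  bound `β_∞ ∏_p β_p ≤ C(t, L) N`, which fails at `(t, L) = (2, 3)`.
* `mass_nonneg` — `β_∞ ∏_p β_p ≥ 0` for non-degenerate systems (with the tree's
  `singularProduct_nonneg` of `Theorems/LeeYangFibresCellParityLawSingularRatio`).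
[folklore]
-/

noncomputable section

namespace Summit.Parity.GeneralizedHardyLittlewood.Theorems.AbsoluteUpgrade.Negative

open Filter Literature.NumberTheory.Sieve
open Summit.Parity.GeneralizedHardyLittlewood.Theses.LeeYangFibres (DimOne RelativeDimOne)
open Summit.Parity.GeneralizedHardyLittlewood.Cruxes.CellParityLaw.SectionAnnihilator.SingularRatio
  (singularProduct_nonneg)

/-! ## Non-negativity of the singular mass -/

/-- `β_∞ ≥ 0`. -/
theorem archFactor_nonneg {d t : ℕ} (Ψ : Fin t → AffLinForm d) (K : Set (Fin d → ℝ)) :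
    0 ≤ archFactor Ψ K :=
  ENNReal.toReal_nonneg

/-- The singular mass `β_∞ ∏_p β_p` of a non-degenerate system is `≥ 0` (`∏_p β_p ≥ 0` is the
tree's `singularProduct_nonneg`, a limit of products of non-negative local factors). -/
theorem mass_nonneg {d t : ℕ} {Ψ : Fin t → AffLinForm d} (hΨ : IsNondegenerateSystem Ψ)
    (K : Set (Fin d → ℝ)) : 0 ≤ archFactor Ψ K * singularProduct Ψ :=
  mul_nonneg (archFactor_nonneg Ψ K) (singularProduct_nonneg hΨ)

/-! ## The two error shapes for a black-box functional -/

/-- A black-box prime-tuple sum: the signature of `vonMangoldtSum` at `d = 1` (`t` explicit). -/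
abbrev SumFunctional : Type :=
  (t : ℕ) → (Fin t → AffLinForm 1) → Set (Fin 1 → ℝ) → ℕ → ℝ

/-- `RelativeDimOne` with `vonMangoldtSum` replaced by a black box `S`. -/
def RelShape (S : SumFunctional) : Prop :=
  ∀ (t L : ℕ), 1 ≤ t → ∀ ε : ℝ, 0 < ε → ∃ N₀ : ℕ, ∀ N : ℕ, N₀ ≤ N →
    ∀ Ψ : Fin t → AffLinForm 1, IsNondegenerateSystem Ψ → affLinSize Ψ N ≤ L →
      ∀ K : Set (Fin 1 → ℝ), Convex ℝ K → K ⊆ realBox 1 N →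
        |S t Ψ K N - archFactor Ψ K * singularProduct Ψ| ≤
          ε * (archFactor Ψ K * singularProduct Ψ + N)

/-- `DimOne` with `vonMangoldtSum` replaced by a black box `S`. -/
def AbsShape (S : SumFunctional) : Prop :=
  ∀ (t L : ℕ), 1 ≤ t → ∀ ε : ℝ, 0 < ε → ∃ N₀ : ℕ, ∀ N : ℕ, N₀ ≤ N →
    ∀ Ψ : Fin t → AffLinForm 1, IsNondegenerateSystem Ψ → affLinSize Ψ N ≤ L →
      ∀ K : Set (Fin 1 → ℝ), Convex ℝ K → K ⊆ realBox 1 N →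
        |S t Ψ K N - archFactor Ψ K * singularProduct Ψ| ≤ ε * (N : ℝ)

/-- The von Mangoldt sum as a `SumFunctional`. -/
def vonMangoldtFunctional : SumFunctional := fun _ Ψ K N => vonMangoldtSum Ψ K N

/-- `RelShape Λ` is `RelativeDimOne` (definitionally). -/
theorem relShape_vonMangoldt_iff : RelShape vonMangoldtFunctional ↔ RelativeDimOne := Iff.rfl

/-- `AbsShape Λ` is `DimOne` (definitionally). -/
theorem absShape_vonMangoldt_iff : AbsShape vonMangoldtFunctional ↔ DimOne := Iff.rfl

/-- **The parametric upgrade** ("relative accuracy implies absolute accuracy for every functional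
of the admissible data"); at `S = Λ` it is the crux `AbsoluteUpgrade`. -/
def UpgradeSchema : Prop :=
  ∀ S : SumFunctional, RelShape S → AbsShape S

/-- The statement of `exists_highMass_pair` (tree, `Theorems/LeeYangFibresAbsoluteUpgradeHighMass`):
for every threshold `M` there are arbitrarily large scales `N` carrying an admissible pair
(`t = 2`, `‖Ψ‖_N ≤ 3`, `K ⊆ [-N, N]` convex) of singular mass `≥ M N`. -/
def HighMassInhabited : Prop :=
  ∀ (M : ℝ) (N₀ : ℕ), ∃ N : ℕ, N₀ ≤ N ∧
    ∃ Ψ : Fin 2 → AffLinForm 1, IsNondegenerateSystem Ψ ∧ affLinSize Ψ N ≤ 3 ∧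
      ∃ K : Set (Fin 1 → ℝ), Convex ℝ K ∧ K ⊆ realBox 1 N ∧
        M * N ≤ archFactor Ψ K * singularProduct Ψ

/-! ## The counterexample functional -/

section Construction

variable (hH : HighMassInhabited)

/-- Scale witness: at scale `w k ≥ k` some admissible pair has mass `≥ k · w k`. -/
def w (k : ℕ) : ℕ := Classical.choose (hH k k)

/-- `w k ≥ k`. -/
theorem le_w (k : ℕ) : k ≤ w hH k := (Classical.choose_spec (hH k k)).1

/-- The pair witnessed at scale `w k`. -/
theorem exists_pair_w (k : ℕ) :
    ∃ Ψ : Fin 2 → AffLinForm 1, IsNondegenerateSystem Ψ ∧ affLinSize Ψ (w hH k) ≤ 3 ∧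
      ∃ K : Set (Fin 1 → ℝ), Convex ℝ K ∧ K ⊆ realBox 1 (w hH k) ∧
        (k : ℝ) * (w hH k) ≤ archFactor Ψ K * singularProduct Ψ :=
  (Classical.choose_spec (hH k k)).2

/-- Every scale is below some witnessed scale. -/
theorem exists_le_w (N : ℕ) : ∃ j : ℕ, N ≤ w hH j := ⟨N, le_w hH N⟩

/-- The slow threshold: `G N` = the least `j` with `N ≤ w j`. -/
def G (N : ℕ) : ℕ := Nat.find (exists_le_w hH N)

/-- `N ≤ w (G N)`. -/
theorem le_w_G (N : ℕ) : N ≤ w hH (G hH N) := Nat.find_spec (exists_le_w hH N)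

/-- Minimality of `G`. -/
theorem G_le {N j : ℕ} (h : N ≤ w hH j) : G hH N ≤ j := Nat.find_min' _ h

/-- At the witnessed scales the threshold is below the witnessed mass ratio. -/
theorem G_w_le (k : ℕ) : G hH (w hH k) ≤ k := G_le hH le_rfl

/-- `G → ∞`. -/
theorem eventually_le_G (J : ℕ) : ∃ N₁ : ℕ, ∀ N : ℕ, N₁ ≤ N → J ≤ G hH N := by
  refine ⟨(Finset.range J).sup (w hH) + 1, fun N hN => ?_⟩
  by_contra hlt
  push Not at hlt
  have h1 : w hH (G hH N) ≤ (Finset.range J).sup (w hH) :=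
    Finset.le_sup (f := w hH) (Finset.mem_range.mpr hlt)
  have h2 := le_w_G hH N
  omega

/-- **The counterexample functional**: the true main term plus an absolute perturbation of size
`N`, switched on exactly on the pairs of singular mass `≥ G(N) · N`. -/
def perturbedSum : SumFunctional := fun _ Ψ K N =>
  archFactor Ψ K * singularProduct Ψ +
    if ((G hH N : ℕ) : ℝ) * N ≤ archFactor Ψ K * singularProduct Ψ then (N : ℝ) else 0

/-- The perturbed functional has RELATIVE accuracy `o(1)` uniformly: where the perturbation is on,
`N ≤ G(N)⁻¹ · mass`, and `G → ∞`. -/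
theorem relShape_perturbedSum : RelShape (perturbedSum hH) := by
  intro t L _ ε hε
  obtain ⟨N₁, hN₁⟩ := eventually_le_G hH (⌈1 / ε⌉₊ + 1)
  refine ⟨N₁, fun N hN Ψ hΨ _ K _ _ => ?_⟩
  have hmass : 0 ≤ archFactor Ψ K * singularProduct Ψ := mass_nonneg hΨ K
  have hN0 : (0 : ℝ) ≤ N := Nat.cast_nonneg N
  simp only [perturbedSum, add_sub_cancel_left]
  split_ifs with hbig
  · rw [abs_of_nonneg hN0]
    have hG : ((⌈1 / ε⌉₊ + 1 : ℕ) : ℝ) ≤ (G hH N : ℝ) := by exact_mod_cast hN₁ N hN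
    have hceil : 1 / ε ≤ (⌈1 / ε⌉₊ : ℝ) := Nat.le_ceil _
    have hG' : 1 / ε < (G hH N : ℝ) := by push_cast at hG; linarith
    have h1 : 1 < (G hH N : ℝ) * ε := (div_lt_iff₀ hε).mp hG'
    have h1' : (1 : ℝ) ≤ ε * (G hH N : ℝ) := by linarith
    calc (N : ℝ) = 1 * N := by ring
      _ ≤ (ε * (G hH N : ℝ)) * N := by gcongr
      _ = ε * (((G hH N : ℕ) : ℝ) * N) := by ring
      _ ≤ ε * (archFactor Ψ K * singularProduct Ψ) := by gcongr
      _ ≤ ε * (archFactor Ψ K * singularProduct Ψ + N) := by gcongr; linarith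
  · rw [abs_zero]
    exact mul_nonneg hε.le (add_nonneg hmass hN0)

/-- ... but not ABSOLUTE accuracy: at the witnessed scales `w k` the perturbation `N` is on
(`t = 2`, `L = 3`, `ε = ½`). -/
theorem not_absShape_perturbedSum : ¬ AbsShape (perturbedSum hH) := by
  intro h
  obtain ⟨N₀, hN₀⟩ := h 2 3 (by norm_num) (1 / 2) (by norm_num)
  obtain ⟨Ψ, hΨ, hL, K, hK, hKN, hbig⟩ := exists_pair_w hH (N₀ + 1)
  have hNk : N₀ + 1 ≤ w hH (N₀ + 1) := le_w hH (N₀ + 1)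
  have hb := hN₀ (w hH (N₀ + 1)) (by omega) Ψ hΨ hL K hK hKN
  have hon : ((G hH (w hH (N₀ + 1)) : ℕ) : ℝ) * (w hH (N₀ + 1) : ℕ) ≤
      archFactor Ψ K * singularProduct Ψ := by
    calc ((G hH (w hH (N₀ + 1)) : ℕ) : ℝ) * (w hH (N₀ + 1) : ℕ)
        ≤ ((N₀ + 1 : ℕ) : ℝ) * (w hH (N₀ + 1) : ℕ) := by
          gcongr
          exact G_w_le hH (N₀ + 1)
      _ ≤ archFactor Ψ K * singularProduct Ψ := hbig
  simp only [perturbedSum, add_sub_cancel_left, if_pos hon, Nat.abs_cast] at hb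
  have h1 : (1 : ℝ) ≤ (w hH (N₀ + 1) : ℕ) := by exact_mod_cast (show 1 ≤ w hH (N₀ + 1) by omega)
  linarith

/-- The perturbed functional is non-negative, like `vonMangoldtSum` (so the schema fails even among
non-negative functionals). -/
theorem perturbedSum_nonneg {t : ℕ} {Ψ : Fin t → AffLinForm 1} (hΨ : IsNondegenerateSystem Ψ)
    (K : Set (Fin 1 → ℝ)) (N : ℕ) : 0 ≤ perturbedSum hH t Ψ K N := by
  have hmass := mass_nonneg hΨ K
  simp only [perturbedSum]
  split_ifs <;> positivity

end Construction

/-- **The parametric upgrade is false** (given the high-mass pairs of the tree): relative accuracy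
`ε (β_∞ ∏_p β_p + N)` uniformly in admissible `(Ψ, K)` does not imply absolute accuracy `ε N` for a
general (even non-negative) functional.  Hence `AbsoluteUpgrade` has no proof that treats
`RelativeDimOne` as a black box. -/
theorem not_upgradeSchema_of_highMass (hH : HighMassInhabited) : ¬ UpgradeSchema :=
  fun h => not_absShape_perturbedSum hH (h _ (relShape_perturbedSum hH))

/-! ### A sharper witness: a multiplicative singular-series bias -/

section Bias

variable (hH : HighMassInhabited)

/-- **Biased Cramér model**: the main term with the singular series multiplied by
`1 + 1/G(N)` on the systems with `∏_p β_p ≥ G(N)/2` (and untouched otherwise).  It is a constant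
density integrated over `K ∩ {Ψ > 0}` — additive and monotone in `K`, non-negative — i.e. it has
every formal property of `vonMangoldtSum` that does not involve the primes. -/
def biasedModel : SumFunctional := fun _ Ψ K N =>
  archFactor Ψ K * singularProduct Ψ *
    (1 + if ((G hH N : ℕ) : ℝ) ≤ 2 * singularProduct Ψ then 1 / ((G hH N : ℕ) : ℝ) else 0)

/-- `biasedModel - mass = mass · bias`. -/
theorem biasedModel_sub (t : ℕ) (Ψ : Fin t → AffLinForm 1) (K : Set (Fin 1 → ℝ)) (N : ℕ) :
    biasedModel hH t Ψ K N - archFactor Ψ K * singularProduct Ψ =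
      archFactor Ψ K * singularProduct Ψ *
        (if ((G hH N : ℕ) : ℝ) ≤ 2 * singularProduct Ψ then 1 / ((G hH N : ℕ) : ℝ) else 0) := by
  simp only [biasedModel]
  ring

/-- The biased model has relative accuracy `1/G(N) → 0` uniformly. -/
theorem relShape_biasedModel : RelShape (biasedModel hH) := by
  intro t L _ ε hε
  obtain ⟨N₁, hN₁⟩ := eventually_le_G hH (⌈1 / ε⌉₊ + 1)
  refine ⟨N₁, fun N hN Ψ hΨ _ K _ _ => ?_⟩
  have hmass : 0 ≤ archFactor Ψ K * singularProduct Ψ := mass_nonneg hΨ K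
  have hN0 : (0 : ℝ) ≤ N := Nat.cast_nonneg N
  rw [biasedModel_sub]
  split_ifs with hbig
  · have hG : ((⌈1 / ε⌉₊ + 1 : ℕ) : ℝ) ≤ (G hH N : ℝ) := by exact_mod_cast hN₁ N hN
    have hceil : 1 / ε ≤ (⌈1 / ε⌉₊ : ℝ) := Nat.le_ceil _
    have hG' : 1 / ε < (G hH N : ℝ) := by push_cast at hG; linarith
    have hGpos : (0 : ℝ) < (G hH N : ℝ) := lt_trans (by positivity) hG'
    have hinv : 1 / ((G hH N : ℕ) : ℝ) ≤ ε := by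
      rw [div_le_iff₀ hGpos]
      have := (div_lt_iff₀ hε).mp hG'
      linarith
    rw [abs_of_nonneg (mul_nonneg hmass (by positivity))]
    calc archFactor Ψ K * singularProduct Ψ * (1 / ((G hH N : ℕ) : ℝ))
        ≤ archFactor Ψ K * singularProduct Ψ * ε := by gcongr
      _ = ε * (archFactor Ψ K * singularProduct Ψ) := by ring
      _ ≤ ε * (archFactor Ψ K * singularProduct Ψ + N) := by gcongr; linarith
  · rw [mul_zero, abs_zero]
    exact mul_nonneg hε.le (add_nonneg hmass hN0)

/-- ... but not absolute accuracy: at a witnessed scale `N = w k` with `1 ≤ G(N) ≤ k`, the pair of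
mass `≥ k N` has `∏_p β_p ≥ k/2 ≥ G(N)/2` (as `β_∞ ≤ 2N`), so the bias is on and the absolute
error is `mass / G(N) ≥ N`. -/
theorem not_absShape_biasedModel : ¬ AbsShape (biasedModel hH) := by
  intro h
  obtain ⟨N₀, hN₀⟩ := h 2 3 (by norm_num) (1 / 2) (by norm_num)
  set k : ℕ := max (N₀ + 1) (w hH 0 + 1) with hk
  obtain ⟨Ψ, hΨ, hL, K, hK, hKN, hbig⟩ := exists_pair_w hH k
  have hNk : k ≤ w hH k := le_w hH k
  have hk1 : N₀ + 1 ≤ k := le_max_left _ _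
  have hk2 : w hH 0 + 1 ≤ k := le_max_right _ _
  have hb := hN₀ (w hH k) (by omega) Ψ hΨ hL K hK hKN
  -- `1 ≤ G (w k) ≤ k`
  have hGk : G hH (w hH k) ≤ k := G_w_le hH k
  have hG1 : 1 ≤ G hH (w hH k) := by
    by_contra h0
    push Not at h0
    have hG0 : G hH (w hH k) = 0 := by omega
    have := le_w_G hH (w hH k)
    rw [hG0] at this
    omega
  have hN1 : (1 : ℝ) ≤ (w hH k : ℕ) := by exact_mod_cast (show 1 ≤ w hH k by omega)
  have hkR : (1 : ℝ) ≤ (k : ℝ) := by exact_mod_cast (show 1 ≤ k by omega)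
  have hGkR : ((G hH (w hH k) : ℕ) : ℝ) ≤ (k : ℝ) := by exact_mod_cast hGk
  have hG1R : (1 : ℝ) ≤ ((G hH (w hH k) : ℕ) : ℝ) := by exact_mod_cast hG1
  have hS0 : 0 ≤ singularProduct Ψ := singularProduct_nonneg hΨ
  have hA := Summit.Parity.GeneralizedHardyLittlewood.Theorems.AbsoluteUpgrade.archFactor_le_two_mul
    Ψ hKN
  -- the bias is on: `G ≤ k ≤ 2 ∏ β_p` since `k · N ≤ β_∞ ∏β_p ≤ 2N ∏β_p`
  have hon : ((G hH (w hH k) : ℕ) : ℝ) ≤ 2 * singularProduct Ψ := by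
    have h2 : (k : ℝ) * (w hH k : ℕ) ≤ 2 * (w hH k : ℕ) * singularProduct Ψ :=
      hbig.trans (mul_le_mul_of_nonneg_right hA hS0)
    have h3 : (k : ℝ) ≤ 2 * singularProduct Ψ := by
      by_contra hlt
      push Not at hlt
      have : 2 * (w hH k : ℕ) * singularProduct Ψ < (k : ℝ) * (w hH k : ℕ) := by nlinarith
      linarith
    linarith
  rw [biasedModel_sub, if_pos hon] at hb
  have hmass : 0 ≤ archFactor Ψ K * singularProduct Ψ := mass_nonneg hΨ K
  rw [abs_of_nonneg (mul_nonneg hmass (by positivity))] at hb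
  -- `mass / G ≥ mass / k ≥ N`
  have hlow : (w hH k : ℕ) ≤ archFactor Ψ K * singularProduct Ψ * (1 / ((G hH (w hH k) : ℕ) : ℝ)) := by
    have hinv : 1 / (k : ℝ) ≤ 1 / ((G hH (w hH k) : ℕ) : ℝ) :=
      one_div_le_one_div_of_le (by linarith) hGkR
    calc ((w hH k : ℕ) : ℝ) = (k : ℝ) * (w hH k : ℕ) * (1 / (k : ℝ)) := by
          field_simp
      _ ≤ archFactor Ψ K * singularProduct Ψ * (1 / (k : ℝ)) := by gcongr
      _ ≤ archFactor Ψ K * singularProduct Ψ * (1 / ((G hH (w hH k) : ℕ) : ℝ)) := by gcongr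
  linarith

/-- The biased model is non-negative. -/
theorem biasedModel_nonneg {t : ℕ} {Ψ : Fin t → AffLinForm 1} (hΨ : IsNondegenerateSystem Ψ)
    (K : Set (Fin 1 → ℝ)) (N : ℕ) : 0 ≤ biasedModel hH t Ψ K N := by
  have hmass := mass_nonneg hΨ K
  simp only [biasedModel]
  split_ifs <;> positivity

end Bias

/-- **The schema fails among biased Cramér models**: given the high-mass pairs, a multiplicative
bias `1 + 1/G(N)` of the singular series on the systems with `∏_p β_p ≥ G(N)/2`, `G → ∞` slowly,
respects `RelShape` and violates `AbsShape`.  READING: given `RelativeDimOne`, the crux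
`AbsoluteUpgrade` is exactly the exclusion of a multiplicative singular-series conspiracy
`1 + η`, `η → 0` slower than `1/∏_p β_p`, on the high-singular-series systems — a "mild" version of
the Siegel illusory correction factor (which is `η ≍ 1` and already breaks `RelativeDimOne`). -/
theorem not_upgradeSchema_of_highMass' (hH : HighMassInhabited) : ¬ UpgradeSchema :=
  fun h => not_absShape_biasedModel hH (h _ (relShape_biasedModel hH))

/-! ## The ε-rescaling bridge and the mass bound it needs -/

/-- Uniform singular-mass bound at every `(t, L)`: `β_∞ ∏_p β_p ≤ C(t, L) N` eventually. -/
def UniformMassBound : Prop :=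
  ∀ t L : ℕ, ∃ C : ℝ, ∃ N₀ : ℕ, ∀ N : ℕ, N₀ ≤ N →
    ∀ Ψ : Fin t → AffLinForm 1, IsNondegenerateSystem Ψ → affLinSize Ψ N ≤ L →
      ∀ K : Set (Fin 1 → ℝ), Convex ℝ K → K ⊆ realBox 1 N →
        archFactor Ψ K * singularProduct Ψ ≤ C * N

/-- Under a uniform mass bound the upgrade IS formal, for any functional: apply the relative shape
with `ε / (C + 1)` (the mechanism of the tree's `t = 1` and bounded-mass slices). -/
theorem upgradeSchema_of_uniformMassBound (h : UniformMassBound) : UpgradeSchema := by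
  intro S hS t L ht ε hε
  obtain ⟨C, N₁, hC⟩ := h t L
  have hC0 : ∀ N : ℕ, N₁ ≤ N → ∀ Ψ : Fin t → AffLinForm 1, IsNondegenerateSystem Ψ →
      affLinSize Ψ N ≤ L → ∀ K : Set (Fin 1 → ℝ), Convex ℝ K → K ⊆ realBox 1 N →
        archFactor Ψ K * singularProduct Ψ ≤ max C 0 * N := fun N hN Ψ hΨ hL K hK hKN =>
    (hC N hN Ψ hΨ hL K hK hKN).trans (by gcongr; exact le_max_left _ _)
  obtain ⟨N₂, hN₂⟩ := hS t L ht (ε / (max C 0 + 1)) (by positivity)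
  refine ⟨max N₁ N₂, fun N hN Ψ hΨ hL K hK hKN => ?_⟩
  have hm := hC0 N (le_of_max_le_left hN) Ψ hΨ hL K hK hKN
  calc |S t Ψ K N - archFactor Ψ K * singularProduct Ψ|
      ≤ ε / (max C 0 + 1) * (archFactor Ψ K * singularProduct Ψ + N) :=
        hN₂ N (le_of_max_le_right hN) Ψ hΨ hL K hK hKN
    _ ≤ ε / (max C 0 + 1) * (max C 0 * N + N) := by gcongr
    _ = ε * (N : ℝ) := by field_simp

/-- **The mass bound is false** (given the high-mass pairs): any proof of the crux must do more
than rescale `ε`. -/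
theorem not_uniformMassBound_of_highMass (hH : HighMassInhabited) : ¬ UniformMassBound :=
  fun h => not_upgradeSchema_of_highMass hH (upgradeSchema_of_uniformMassBound h)

/-- The mass bound fails already at `(t, L) = (2, 3)` (primorial shift pairs). -/
theorem not_massBound_two_three_of_highMass (hH : HighMassInhabited) :
    ¬ ∃ C : ℝ, ∃ N₀ : ℕ, ∀ N : ℕ, N₀ ≤ N →
      ∀ Ψ : Fin 2 → AffLinForm 1, IsNondegenerateSystem Ψ → affLinSize Ψ N ≤ 3 →
        ∀ K : Set (Fin 1 → ℝ), Convex ℝ K → K ⊆ realBox 1 N →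
          archFactor Ψ K * singularProduct Ψ ≤ C * N := by
  rintro ⟨C, N₀, hC⟩
  obtain ⟨N, hN, Ψ, hΨ, hL, K, hK, hKN, hbig⟩ := hH (C + 1) (max N₀ 1)
  have hle := hC N (le_of_max_le_left hN) Ψ hΨ hL K hK hKN
  have hN1 : (1 : ℝ) ≤ N := by exact_mod_cast le_of_max_le_right hN
  nlinarith

end Summit.Parity.GeneralizedHardyLittlewood.Theorems.AbsoluteUpgrade.Negative

end
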